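import Summits.QuantumFields.YangMills.Theorems.BalabanLadderNTClassicalShadowBoundaryLayer
import Summits.QuantumFields.YangMills.Theorems.BalabanLadderNTClassicalShadowOrbitGauge
import HarnessLib

/-!
# Crux `NT` (stmt-QuantumFields-19353), stub `stub_refpkgT : RefPkgT`: THE CLASSICAL SHADOW, VII — LONG-RANGE ORDER in frustrated boxes
# NEGATES clause 2: the classical kill-path as ONE named hypothesis, and what it does (not) refute

Helper file (`--supports stmt-QuantumFields-19353`) of the fleet lead prover of crux `NT` (unit `ym-spine-19353-p1`, GEN 15); sequel of
`…NTClassicalShadowBoundaryLayer` (this generation) and `…NTClassicalShadowOrbit[Gauge]` (p601276, p603177).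

THE POINT.  Lead g14's orbit test turns a symmetric frustrated box whose Wilson-action ground states break the box symmetry into an
INSTANCE floor `C₂ ≥ min d⁴(1+‖y−x‖)⁴·|Cov_Γ|` on the oscillation constant of clause 2 (kit, `SU(2)` fundamental, coherent `na`/`sd`
exteriors: floors `0.16 → 1.8 → 65 → 288 → 890` for `b = 4, 5, 6, 8, 10`, the zero-temperature orbit covariance of depth-2 sites staying
`≈ 10⁻³` FLAT across the box while the reachable separation grows — memo SIZING-19353-g14 §2(e)(f)).  Clause 2 is asked for every cube
`b ≤ ℓ/a(β) → ∞`, so if these floors are UNBOUNDED along a family of boxes no constant `C₂` survives.  This file types that passage: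

* §1 `ZeroTempCovFloorUnbounded G r` (def) — along cubes, exteriors and pairs of cube sites (depth `≥ 1`), the weighted zero-temperature
  conditional covariance `min d⁴·(1+‖y−x‖)⁴·|kerCov^η_β(dens_x, dens_y)|` is frequently-in-`β` larger than any constant; sufficient
  conditions: `zeroTempCovFloorUnbounded_of_nondecaying` (a contrast floor `c₀ > 0` at unbounded separation — long-range order proper) and
  **`zeroTempCovFloorUnbounded_of_orbit`** from the variational/orbit form `ClassicalOrbitCovFloorUnbounded G r` (def: one-orbit degenerate
  boxes with unbounded orbit floors — exactly the quantity the classical programme measures);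
* §2 **`not_e2osc_of_zeroTempCovFloorUnbounded`**, **`not_e2osc_of_classicalOrbitCovFloorUnbounded`** — for EVERY unit `a → 0`, every `ℓ > 0`
  and every `C₂`, clause 2 of the package FAILS at `(G, r)`; the null case `tendsto_kerCov_gaugeTransformZd_one_dens` (an exterior that is
  a lattice gauge transform of the identity carries NO zero-temperature covariance: long-range order needs curvature in the boundary
  plaquettes); the clause-3 twin `ZeroTempK3FloorUnbounded` / `not_e3osc_of_zeroTempK3FloorUnbounded`;
* §3 WHAT IT REFUTES: **`refPkgAt_false_of_zeroTempCovFloorUnbounded`** — if EVERY lattice representation `r` of `G` has the unbounded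
  floor, the `G`-instance of the registered package body (the hypothesis of `Reference.nt_of_torusReferencePackage` at `G`, i.e. `RefPkgT`
  specialised to `G`) is FALSE for every unit and all constants.  Located remark made formal (g14 §3(d)): `RefPkgT` is `∀ G, ∃ r, …`, so a
  classical kill of the `(SU(2), rF)` INSTANCE (`not_e2osc_…` at one `r`) is not a kill of the stub; the honest classical hypothesis that
  refutes the stub is `∀ r : LatticeRep G, ZeroTempCovFloorUnbounded G r` at ONE compact simple `G` — a statement about the Wilson-action
  energy landscape of EVERY faithful unitary representation, which instance numerics can support but never exhaust.

HONEST FRAMING.  Real analysis over tree theorems; the two `def`s are HYPOTHESES (classical / zero-temperature statements about frustrated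
boxes) that nothing in the tree proves for any `(G, r)`; kit evidence (lead g14) concerns minimisers FOUND at `(SU(2), rF)`, `b ≤ 10`.  No floor,
not AF, not NT, not the seam, not the gap; not Clay.
-/

set_option autoImplicit false

noncomputable section

open scoped SchwartzMap
open MeasureTheory Filter Topology
open Literature.MathematicalPhysics.QuantumFieldTheory Literature.MathematicalPhysics.QuantumLattice
open Literature.Probability.LatticeModels
open Summit.QuantumFields.YangMills.Cruxes.OSLegsFromFemtoAndGap.DlrCollarTransfer
open Summit.QuantumFields.YangMills.Cruxes.UVSeamRec.BoundaryLawPenetration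

namespace Summit.QuantumFields.YangMills.Cruxes.NT.ClassicalShadow

/-! ## §1 The hypotheses: unbounded zero-temperature covariance floors -/

section Defs

variable (G : Type) [Group G] [TopologicalSpace G] [IsTopologicalGroup G] [CompactSpace G]
  [MeasurableSpace G] [BorelSpace G] (r : LatticeRep G)

/-- **Unbounded zero-temperature covariance floor of `(G, r)`** (kernel form).  For every constant `C` there are a cube `(c, b)`, an
exterior `η` and two cube sites `x, y` (depth `≥ 1`) at which, for arbitrarily large `β`, the conditional covariance of the action densities
weighted by the registered clause-2 envelope exceeds `C`: `C < min(d_x,d_y)⁴ · (1 + ‖y − x‖)⁴ · |kerCov^η_β(dens_x, dens_y)|`.  (The symmetric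
mixture of symmetry-broken classical ground states of a frustrated box is the intended source: its covariance between shallow sites does not
decay with their separation while the box, hence the separation, is unbounded.)  A HYPOTHESIS — asserted for no `(G, r)` in the tree. -/
def ZeroTempCovFloorUnbounded : Prop :=
  ∀ C : ℝ, ∃ (c : Fin 4 → ℤ) (b : ℕ) (η : LGConfig 4 G) (x y : Fin 4 → ℤ), 1 ≤ depth c b x ∧ 1 ≤ depth c b y ∧
    ∃ᶠ β : ℝ in atTop, C < ((min (depth c b x) (depth c b y) : ℕ) : ℝ) ^ 4 * (1 + ‖siteToE (y - x)‖) ^ 4 *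
      |kerCov G r β c b η (dens G r x) (dens G r y)|

/-- **Unbounded classical orbit floor of `(G, r)`** (variational form, the quantity the classical programme computes).  For every `C` there
are a cube, an exterior `η`, a finite family `γ₀, …, γ_k` of continuous maps of the configuration space leaving the cube kernel of `η`
invariant (`kerE^η_β(F ∘ γᵢ) = kerE^η_β(F)`, continuous `F`), two cube sites `x, y` and the ground-state values `M₁, M₂, M₁₂` of the orbit sums
of `dens_x`, `dens_y`, `dens_x·dens_y` (constant on `cubeMinimisers`, e.g. because the ground states form ONE orbit), whose ORBIT COVARIANCE
weighted by the clause-2 envelope exceeds `C`: `C < min d⁴ (1+‖y−x‖)⁴ |M₁₂/(k+1) − (M₁/(k+1))(M₂/(k+1))|`.  A HYPOTHESIS. -/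
def ClassicalOrbitCovFloorUnbounded : Prop :=
  ∀ C : ℝ, ∃ (c : Fin 4 → ℤ) (b : ℕ) (η : LGConfig 4 G) (k : ℕ) (γ : Fin (k + 1) → LGConfig 4 G → LGConfig 4 G)
    (x y : Fin 4 → ℤ) (M₁ M₂ M₁₂ : ℝ),
    (∀ i, Continuous (γ i)) ∧
    (∀ (β : ℝ) (i : Fin (k + 1)) (F : LGConfig 4 G → ℝ), Continuous F → kerE G r β c b η (F ∘ γ i) = kerE G r β c b η F) ∧
    1 ≤ depth c b x ∧ 1 ≤ depth c b y ∧
    (∀ ζ ∈ cubeMinimisers G r c b η, ∑ i, dens G r x (γ i (glueWith (cubeEdges c b) ζ η)) = M₁) ∧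
    (∀ ζ ∈ cubeMinimisers G r c b η, ∑ i, dens G r y (γ i (glueWith (cubeEdges c b) ζ η)) = M₂) ∧
    (∀ ζ ∈ cubeMinimisers G r c b η,
      ∑ i, dens G r x (γ i (glueWith (cubeEdges c b) ζ η)) * dens G r y (γ i (glueWith (cubeEdges c b) ζ η)) = M₁₂) ∧
    C < ((min (depth c b x) (depth c b y) : ℕ) : ℝ) ^ 4 * (1 + ‖siteToE (y - x)‖) ^ 4 *
      |M₁₂ / (k + 1 : ℕ) - M₁ / (k + 1 : ℕ) * (M₂ / (k + 1 : ℕ))|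

/-- **Unbounded zero-temperature third-cumulant floor of `(G, r)`** (the clause-3 twin of `ZeroTempCovFloorUnbounded`, weight = the registered
clause-3 envelope `min d⁴ · (1 + min separation)⁸`).  A HYPOTHESIS. -/
def ZeroTempK3FloorUnbounded : Prop :=
  ∀ C : ℝ, ∃ (c : Fin 4 → ℤ) (b : ℕ) (η : LGConfig 4 G) (x y z : Fin 4 → ℤ), 1 ≤ depth c b x ∧ 1 ≤ depth c b y ∧ 1 ≤ depth c b z ∧
    ∃ᶠ β : ℝ in atTop, C < ((min (min (depth c b x) (depth c b y)) (depth c b z) : ℕ) : ℝ) ^ 4 *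
      (1 + min (min ‖siteToE (y - x)‖ ‖siteToE (z - y)‖) ‖siteToE (z - x)‖) ^ 8 * |kerK3 G r β c b η x y z|

end Defs

variable {G : Type} [Group G] [TopologicalSpace G] [IsTopologicalGroup G] [CompactSpace G]
  [MeasurableSpace G] [BorelSpace G] (r : LatticeRep G)

/-- **Long-range order proper ⇒ unbounded floor.**  A contrast floor `c₀ > 0` on the zero-temperature conditional covariance of two cube
sites at UNBOUNDED separation (for every `n` a cube, an exterior and two cube sites `‖y − x‖ ≥ n` with `|kerCov^η_β| ≥ c₀` for arbitrarily
large `β`) makes the weighted floor unbounded. [folklore] -/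
theorem zeroTempCovFloorUnbounded_of_nondecaying {c₀ : ℝ} (hc₀ : 0 < c₀)
    (h : ∀ n : ℕ, ∃ (c : Fin 4 → ℤ) (b : ℕ) (η : LGConfig 4 G) (x y : Fin 4 → ℤ), 1 ≤ depth c b x ∧ 1 ≤ depth c b y ∧
      (n : ℝ) ≤ ‖siteToE (y - x)‖ ∧ ∃ᶠ β : ℝ in atTop, c₀ ≤ |kerCov G r β c b η (dens G r x) (dens G r y)|) :
    ZeroTempCovFloorUnbounded G r := by
  intro C
  obtain ⟨n, hn⟩ := exists_nat_gt (C / c₀)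
  obtain ⟨c, b, η, x, y, hx, hy, hsep, hfreq⟩ := h n
  refine ⟨c, b, η, x, y, hx, hy, hfreq.mono fun β hβ => ?_⟩
  have hD : (1 : ℝ) ≤ ((min (depth c b x) (depth c b y) : ℕ) : ℝ) ^ 4 :=
    one_le_pow₀ (by exact_mod_cast le_min hx hy)
  have hN : (1 : ℝ) + n ≤ (1 + ‖siteToE (y - x)‖) ^ 4 := by
    have h1 : (1 : ℝ) + n ≤ 1 + ‖siteToE (y - x)‖ := by linarith
    have h2 : (1 : ℝ) ≤ 1 + ‖siteToE (y - x)‖ := by linarith [norm_nonneg (siteToE (y - x))]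
    calc (1 : ℝ) + n ≤ 1 + ‖siteToE (y - x)‖ := h1
      _ = (1 + ‖siteToE (y - x)‖) ^ 1 := (pow_one _).symm
      _ ≤ (1 + ‖siteToE (y - x)‖) ^ 4 := pow_le_pow_right₀ h2 (by norm_num)
  have hC : C < c₀ * (1 + n) := by
    rw [div_lt_iff₀ hc₀] at hn
    nlinarith
  have hprod : c₀ * (1 + n) ≤ ((min (depth c b x) (depth c b y) : ℕ) : ℝ) ^ 4 * (1 + ‖siteToE (y - x)‖) ^ 4 *
      |kerCov G r β c b η (dens G r x) (dens G r y)| := by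
    have h0 : 0 ≤ (1 + ‖siteToE (y - x)‖) ^ 4 := by positivity
    calc c₀ * (1 + n) = 1 * (1 + (n : ℝ)) * c₀ := by ring
      _ ≤ ((min (depth c b x) (depth c b y) : ℕ) : ℝ) ^ 4 * (1 + ‖siteToE (y - x)‖) ^ 4 * c₀ := by
          gcongr
      _ ≤ _ := by gcongr
  exact lt_of_lt_of_le hC hprod

/-- **Orbit form ⇒ kernel form.**  On a one-orbit degenerate box the zero-temperature conditional covariance CONVERGES to the orbit
covariance (`tendsto_kerCov_of_orbit`), so an unbounded orbit floor is an unbounded zero-temperature floor. [folklore] -/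
theorem zeroTempCovFloorUnbounded_of_orbit (h : ClassicalOrbitCovFloorUnbounded G r) : ZeroTempCovFloorUnbounded G r := by
  intro C
  obtain ⟨c, b, η, k, γ, x, y, M₁, M₂, M₁₂, hγ, hsymm, hx, hy, h₁, h₂, h₁₂, hC⟩ := h C
  refine ⟨c, b, η, x, y, hx, hy, ?_⟩
  have hlim : Tendsto (fun β : ℝ => kerCov G r β c b η (dens G r x) (dens G r y)) atTop
      (𝓝 (M₁₂ / (k + 1 : ℕ) - M₁ / (k + 1 : ℕ) * (M₂ / (k + 1 : ℕ)))) := by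
    have h := tendsto_kerCov_of_orbit r c b η γ hγ h₁ h₂ h₁₂
      (fun β i => hsymm β i _ (continuous_dens r x)) (fun β i => hsymm β i _ (continuous_dens r y))
      (fun β i => hsymm β i _ ((continuous_dens r x).mul (continuous_dens r y)))
    rwa [Fintype.card_fin] at h
  have hw := (hlim.abs.const_mul (((min (depth c b x) (depth c b y) : ℕ) : ℝ) ^ 4 * (1 + ‖siteToE (y - x)‖) ^ 4)).eventually
    (lt_mem_nhds hC)
  exact hw.frequently

/-! ## §2 The negations -/

section Negation

variable (a : ℝ → ℝ)

/-- **An unbounded zero-temperature covariance floor NEGATES clause 2** of the registered package at `(G, r)`, for EVERY unit map `a → 0`,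
every femto range `ℓ > 0` and every constant `C₂`: by `zeroTemp_kerCov_le_of_e2osc_depthOne` clause 2 caps the weighted zero-temperature
covariance of every exterior by `C₂ + 1` eventually, against a floor `> C₂ + 1` frequently. [folklore] -/
theorem not_e2osc_of_zeroTempCovFloorUnbounded (h : ZeroTempCovFloorUnbounded G r) (ha0 : Tendsto a atTop (𝓝 0)) {ℓ : ℝ}
    (hℓ : 0 < ℓ) (C₂ : ℝ) :
    ¬ ∃ β₂ : ℝ, ∀ β : ℝ, β₂ ≤ β → ∀ (c : Fin 4 → ℤ) (b : ℕ), (b : ℝ) * a β ≤ ℓ →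
      ∀ (η η' : LGConfig 4 G) (x y : Fin 4 → ℤ), 1 ≤ depth c b x → 1 ≤ depth c b y →
        |kerCov G r β c b η (dens G r x) (dens G r y) - kerCov G r β c b η' (dens G r x) (dens G r y)| ≤
          C₂ / ((min (depth c b x) (depth c b y) : ℕ) : ℝ) ^ 4 / (1 + ‖siteToE (y - x)‖) ^ 4 := by
  intro hE2
  obtain ⟨c, b, η, x, y, hx, hy, hfreq⟩ := h (C₂ + 1)
  set D : ℝ := ((min (depth c b x) (depth c b y) : ℕ) : ℝ) ^ 4 with hD_def
  set N : ℝ := (1 + ‖siteToE (y - x)‖) ^ 4 with hN_def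
  have hD : 0 < D := pow_pos (by exact_mod_cast lt_of_lt_of_le Nat.zero_lt_one (le_min hx hy)) 4
  have hN : 0 < N := by positivity
  have hev := zeroTemp_kerCov_le_of_e2osc_depthOne r a ha0 hℓ hE2 c b hx hy η (e := 1 / (D * N)) (by positivity)
  obtain ⟨β, hβC, hβle⟩ := (hfreq.and_eventually hev).exists
  have hle : D * N * |kerCov G r β c b η (dens G r x) (dens G r y)| ≤ C₂ + 1 := by
    have h1 := mul_le_mul_of_nonneg_left hβle (mul_pos hD hN).le
    have e : D * N * (C₂ / D / N + 1 / (D * N)) = C₂ + 1 := by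
      field_simp
    linarith
  linarith

/-- **The classical kill-path of clause 2, end to end**: a family of one-orbit degenerate boxes with unbounded orbit floors at `(G, r)`
negates clause 2 for every unit `a → 0`, every `ℓ > 0`, every `C₂`. [folklore] -/
theorem not_e2osc_of_classicalOrbitCovFloorUnbounded (h : ClassicalOrbitCovFloorUnbounded G r) (ha0 : Tendsto a atTop (𝓝 0))
    {ℓ : ℝ} (hℓ : 0 < ℓ) (C₂ : ℝ) :
    ¬ ∃ β₂ : ℝ, ∀ β : ℝ, β₂ ≤ β → ∀ (c : Fin 4 → ℤ) (b : ℕ), (b : ℝ) * a β ≤ ℓ →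
      ∀ (η η' : LGConfig 4 G) (x y : Fin 4 → ℤ), 1 ≤ depth c b x → 1 ≤ depth c b y →
        |kerCov G r β c b η (dens G r x) (dens G r y) - kerCov G r β c b η' (dens G r x) (dens G r y)| ≤
          C₂ / ((min (depth c b x) (depth c b y) : ℕ) : ℝ) ^ 4 / (1 + ‖siteToE (y - x)‖) ^ 4 :=
  not_e2osc_of_zeroTempCovFloorUnbounded r a (zeroTempCovFloorUnbounded_of_orbit r h) ha0 hℓ C₂

/-- **The clause-3 twin**: an unbounded zero-temperature third-cumulant floor negates clause 3 at `(G, r)` for every unit `a → 0`, every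
`ℓ > 0`, every `C₃` (`zeroTemp_kerK3_le_of_e3osc_depthOne`). [folklore] -/
theorem not_e3osc_of_zeroTempK3FloorUnbounded (h : ZeroTempK3FloorUnbounded G r) (ha0 : Tendsto a atTop (𝓝 0)) {ℓ : ℝ}
    (hℓ : 0 < ℓ) (C₃ : ℝ) :
    ¬ ∃ β₃ : ℝ, ∀ β : ℝ, β₃ ≤ β → ∀ (c : Fin 4 → ℤ) (b : ℕ), (b : ℝ) * a β ≤ ℓ →
      ∀ (η η' : LGConfig 4 G) (x y z : Fin 4 → ℤ), 1 ≤ depth c b x → 1 ≤ depth c b y → 1 ≤ depth c b z →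
        |kerK3 G r β c b η x y z - kerK3 G r β c b η' x y z| ≤
          C₃ / ((min (min (depth c b x) (depth c b y)) (depth c b z) : ℕ) : ℝ) ^ 4 /
            (1 + min (min ‖siteToE (y - x)‖ ‖siteToE (z - y)‖) ‖siteToE (z - x)‖) ^ 8 := by
  intro hE3
  obtain ⟨c, b, η, x, y, z, hx, hy, hz, hfreq⟩ := h (C₃ + 1)
  set D : ℝ := ((min (min (depth c b x) (depth c b y)) (depth c b z) : ℕ) : ℝ) ^ 4 with hD_def
  set N : ℝ := (1 + min (min ‖siteToE (y - x)‖ ‖siteToE (z - y)‖) ‖siteToE (z - x)‖) ^ 8 with hN_def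
  have hD : 0 < D := pow_pos (by exact_mod_cast lt_of_lt_of_le Nat.zero_lt_one (le_min (le_min hx hy) hz)) 4
  have hN : 0 < N := by positivity
  have hev := zeroTemp_kerK3_le_of_e3osc_depthOne r a ha0 hℓ hE3 c b hx hy hz η (e := 1 / (D * N)) (by positivity)
  obtain ⟨β, hβC, hβle⟩ := (hfreq.and_eventually hev).exists
  have hle : D * N * |kerK3 G r β c b η x y z| ≤ C₃ + 1 := by
    have h1 := mul_le_mul_of_nonneg_left hβle (mul_pos hD hN).le
    have e : D * N * (C₃ / D / N + 1 / (D * N)) = C₃ + 1 := by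
      field_simp
    linarith
  linarith

end Negation

/-! ### The null case: exteriors that are gauge transforms of the identity carry no zero-temperature covariance -/

/-- **Long-range order needs curvature in the boundary plaquettes.**  For an exterior `gaugeTransformZd g 1` (a lattice gauge transform of the
identity configuration) the zero-temperature conditional covariance of the action densities at ANY two sites vanishes: by the gauge
covariance of the cube kernels (`kerE_gaugeTransformZd`) and the gauge invariance of `dens` it equals the identity-exterior covariance,
which tends to `0` (`tendsto_kerCov_one_dens_all`). [folklore] -/
theorem tendsto_kerCov_gaugeTransformZd_one_dens (c : Fin 4 → ℤ) (b : ℕ) (g : Site 4 → G) (x y : Fin 4 → ℤ) :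
    Tendsto (fun β : ℝ => kerCov G r β c b (gaugeTransformZd g 1) (dens G r x) (dens G r y)) atTop (𝓝 0) := by
  haveI : SecondCountableTopology G := (Continuous.isClosedEmbedding r.continuous r.injective).isEmbedding.secondCountableTopology
  have e : ∀ β : ℝ, kerCov G r β c b (gaugeTransformZd g 1) (dens G r x) (dens G r y) = kerCov G r β c b 1 (dens G r x) (dens G r y) := by
    intro β
    unfold kerCov
    rw [kerE_gaugeTransformZd r β c b 1 g (F := fun U => dens G r x U * dens G r y U)
        ((continuous_dens r x).mul (continuous_dens r y)).measurable,
      kerE_gaugeTransformZd r β c b 1 g (F := dens G r x) (continuous_dens r x).measurable,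
      kerE_gaugeTransformZd r β c b 1 g (F := dens G r y) (continuous_dens r y).measurable]
    simp only [Function.comp_def, dens_gaugeTransformZd]
  simp_rw [e]
  exact tendsto_kerCov_one_dens_all r c b x y

/-- Hence a gauge-transformed identity exterior never witnesses a covariance floor: eventually in `β` its weighted zero-temperature
covariance is below any `C > 0`. [folklore] -/
theorem eventually_weightedCov_gaugeTransformZd_one_lt (c : Fin 4 → ℤ) (b : ℕ) (g : Site 4 → G) (x y : Fin 4 → ℤ) {C : ℝ} (hC : 0 < C) :
    ∀ᶠ β : ℝ in atTop, ((min (depth c b x) (depth c b y) : ℕ) : ℝ) ^ 4 * (1 + ‖siteToE (y - x)‖) ^ 4 *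
      |kerCov G r β c b (gaugeTransformZd g 1) (dens G r x) (dens G r y)| < C := by
  have h := ((tendsto_kerCov_gaugeTransformZd_one_dens r c b g x y).abs.const_mul
    (((min (depth c b x) (depth c b y) : ℕ) : ℝ) ^ 4 * (1 + ‖siteToE (y - x)‖) ^ 4))
  rw [abs_zero, mul_zero] at h
  exact h.eventually (gt_mem_nhds hC)

/-! ## §3 What the classical kill-path refutes: the `G`-instance of the registered package, given the floor for EVERY representation -/

section Package

variable (G : Type) [Group G] [TopologicalSpace G] [IsTopologicalGroup G] [CompactSpace G]
  [MeasurableSpace G] [BorelSpace G]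

/-- **The `G`-instance of the registered package is false under representation-uniform classical long-range order.**  If EVERY lattice
representation `r` of `G` has an unbounded zero-temperature covariance floor, then NO `(r, a)` with `a > 0`, `a → 0` carries the periodic
reference package (the body of `RefPkgT` / the hypothesis of `Reference.nt_of_torusReferencePackage` at `G`, any measurable structure):
its clause 2 fails by `not_e2osc_of_zeroTempCovFloorUnbounded` (`ℓ > 2(σ+κ) > 0`).  The hypothesis quantifies over ALL faithful unitary
representations — an instance kill at one `r` does not give it. [folklore] -/
theorem refPkgAt_false_of_zeroTempCovFloorUnbounded (hLRO : ∀ r : LatticeRep G, ZeroTempCovFloorUnbounded G r) :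
    ¬ ∃ (r : LatticeRep G) (a : ℝ → ℝ), (∀ β, 0 < a β) ∧ Tendsto a atTop (𝓝 0) ∧
      ∃ (C₁ C₂ C₃ ℓ σ κ : ℝ), 0 ≤ C₁ ∧ 0 ≤ C₂ ∧ 0 ≤ C₃ ∧ 0 < σ ∧ 0 < κ ∧ 2 * (σ + κ) < ℓ ∧
      (∃ β₁ : ℝ, ∀ β : ℝ, β₁ ≤ β → ∀ (c : Fin 4 → ℤ) (b : ℕ), (b : ℝ) * a β ≤ ℓ →
        ∀ (η η' : LGConfig 4 G) (x : Fin 4 → ℤ), 1 ≤ depth c b x →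
          |kerE G r β c b η (dens G r x) - kerE G r β c b η' (dens G r x)| ≤ C₁ / (depth c b x : ℝ) ^ 4) ∧
      (∃ β₂ : ℝ, ∀ β : ℝ, β₂ ≤ β → ∀ (c : Fin 4 → ℤ) (b : ℕ), (b : ℝ) * a β ≤ ℓ →
        ∀ (η η' : LGConfig 4 G) (x y : Fin 4 → ℤ), 1 ≤ depth c b x → 1 ≤ depth c b y →
          |kerCov G r β c b η (dens G r x) (dens G r y) - kerCov G r β c b η' (dens G r x) (dens G r y)| ≤
            C₂ / ((min (depth c b x) (depth c b y) : ℕ) : ℝ) ^ 4 / (1 + ‖siteToE (y - x)‖) ^ 4) ∧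
      (∃ β₃ : ℝ, ∀ β : ℝ, β₃ ≤ β → ∀ (c : Fin 4 → ℤ) (b : ℕ), (b : ℝ) * a β ≤ ℓ →
        ∀ (η η' : LGConfig 4 G) (x y z : Fin 4 → ℤ), 1 ≤ depth c b x → 1 ≤ depth c b y → 1 ≤ depth c b z →
          |kerK3 G r β c b η x y z - kerK3 G r β c b η' x y z| ≤
            C₃ / ((min (min (depth c b x) (depth c b y)) (depth c b z) : ℕ) : ℝ) ^ 4 /
              (1 + min (min ‖siteToE (y - x)‖ ‖siteToE (z - y)‖) ‖siteToE (z - x)‖) ^ 8) ∧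
      (∃ (v : 𝓢(EuclideanSpace ℝ (Fin 4), ℝ)) (ε β₅ : ℝ) (L₀ : ℝ → ℕ),
        tsupport (v : EuclideanSpace ℝ (Fin 4) → ℝ) ⊆ {y | 0 < y 0} ∧
        tsupport (v : EuclideanSpace ℝ (Fin 4) → ℝ) ⊆ Metric.closedBall 0 σ ∧ 0 < ε ∧
        ∀ β : ℝ, β₅ ≤ β → σ + κ + 1 ≤ a β * L₀ β ∧
          ε + 2 * (C₁ * (a β / κ) ^ 4 * ∑ x ∈ box 4 (L₀ β), |thetaTest 4 v (a β • siteToE x)|) *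
                (C₁ * (a β / κ) ^ 4 * ∑ y ∈ box 4 (L₀ β), |v (a β • siteToE y)|) +
              C₂ * (a β / κ) ^ 4 * ∑ x ∈ box 4 (L₀ β), ∑ y ∈ box 4 (L₀ β),
                |thetaTest 4 v (a β • siteToE x)| * |v (a β • siteToE y)| / (1 + ‖siteToE (y - x)‖) ^ 4 ≤
            Q2 G r β (L₀ β) (a β) (thetaTest 4 v) v) ∧
      (∃ (f g h : 𝓢(EuclideanSpace ℝ (Fin 4), ℝ)) (ε β₅ : ℝ) (L₀ : ℝ → ℕ),
        Disjoint (tsupport (f : EuclideanSpace ℝ (Fin 4) → ℝ)) (tsupport (g : EuclideanSpace ℝ (Fin 4) → ℝ)) ∧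
        Disjoint (tsupport (g : EuclideanSpace ℝ (Fin 4) → ℝ)) (tsupport (h : EuclideanSpace ℝ (Fin 4) → ℝ)) ∧
        Disjoint (tsupport (f : EuclideanSpace ℝ (Fin 4) → ℝ)) (tsupport (h : EuclideanSpace ℝ (Fin 4) → ℝ)) ∧
        tsupport (f : EuclideanSpace ℝ (Fin 4) → ℝ) ⊆ Metric.closedBall 0 σ ∧
        tsupport (g : EuclideanSpace ℝ (Fin 4) → ℝ) ⊆ Metric.closedBall 0 σ ∧
        tsupport (h : EuclideanSpace ℝ (Fin 4) → ℝ) ⊆ Metric.closedBall 0 σ ∧ 0 < ε ∧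
        ∀ β : ℝ, β₅ ≤ β → σ + κ + 1 ≤ a β * L₀ β ∧
          ε + ∑ x ∈ box 4 (L₀ β), ∑ y ∈ box 4 (L₀ β), ∑ z ∈ box 4 (L₀ β),
              |f (a β • siteToE x)| * |g (a β • siteToE y)| * |h (a β • siteToE z)| *
                (2 * ((C₁ * (a β / κ) ^ 4) * (C₂ * (a β / κ) ^ 4 / (1 + ‖siteToE (z - y)‖) ^ 4) +
                      (C₁ * (a β / κ) ^ 4) * (C₂ * (a β / κ) ^ 4 / (1 + ‖siteToE (z - x)‖) ^ 4) +
                      (C₁ * (a β / κ) ^ 4) * (C₂ * (a β / κ) ^ 4 / (1 + ‖siteToE (y - x)‖) ^ 4) +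
                      (C₁ * (a β / κ) ^ 4) * (C₁ * (a β / κ) ^ 4) * (C₁ * (a β / κ) ^ 4)) +
                  C₃ * (a β / κ) ^ 4 /
                    (1 + min (min ‖siteToE (y - x)‖ ‖siteToE (z - y)‖) ‖siteToE (z - x)‖) ^ 8) ≤
            |Q3 G r β (L₀ β) (a β) f g h|) := by
  rintro ⟨r, a, -, ha, C₁, C₂, C₃, ℓ, σ, κ, -, -, -, hσ, hκ, hℓ, -, hE2, -⟩
  exact not_e2osc_of_zeroTempCovFloorUnbounded r a (hLRO r) ha (by linarith) C₂ hE2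

end Package

end Summit.QuantumFields.YangMills.Cruxes.NT.ClassicalShadow

end
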